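import Summits.KontsevichZagierPeriods.KontsevichZagierPeriods.Theorems.RootDecompQuadraticDescentZetaTwoPairsP1

/-!
# The ZETA2 stratum (15 census pairs among R1..R6 ∈ π²ℚ) DECIDED in `KZ.relations` (route `RootDecompQuadraticDescent`, instances of crux stmt-KontsevichZagierPeriods-28994 / stmt-4280) · part 2/5

Cell `decomp-kz`, lens 6 (decomp-kz-lens-6 g8b): ENGINE v3.1 — the bounded «triangle calculus» on sub-graph representations `SB(c;L,U)` (`sb_cut/affine/swap/unfold/add′`, `rel_opn/scale/shift/powB` ⟹ `sb_pow`; `rel_scale` over the OPEN base via `KZ.of_sub_of_mem_relations_of_affine`) decides every pair #23 #34 #35 #38–#49 of the cell census as an INTEGER relation (normal forms R1≡2A, R2≡4A−4W, R3≡2A−T, R4≡4W−2T, R5≡2W+2T, R6≡3W, 2T≡A, 3W≡2A); packaged `zetaTwoStratum_descentTwoQ_instances` and `zetaTwoPair_of_kzDimTwo` BY NAME.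

Source: `HOME/decomp-kz-lens-6/g8/ZetaTwoPairs.lean` sha256 a8aac2aea5cc880c (1299 l; critic decomp-kz-crit-1 g2 CLEARED 2026-08-30T09:03:21Z, std axioms), split into 5 modules by the landing seat decomp-kz-census-1 g7 (contexts re-opened per part; generic docstrings added where the source had none; the route file is imported only by the last part, which proves the `KZDimTwo` corollaries BY NAME).  No `sorry`; standard axioms.  References: [cite: KontsevichZagier2001, §1.2].
-/

noncomputable section

open MeasureTheory Set MvPolynomial

namespace Summit.KontsevichZagierPeriods.RootDecompQuadraticDescent.ZetaTwoPairs

open Literature.NumberTheory.Transcendental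
open Literature.NumberTheory.Transcendental.KZ
open Literature.ModelTheory.ExponentialFields (IsSemialgebraic)

-- PRIVATE copy (landed twin lives in a farm-unbuilt module; dedup.landed): snoc2_zero, snoc2_one, init2_zero, last_one_eq
/-- `snoc2_zero`: auxiliary theorem of the lens-6 development «zeta2» (instances of 28994/4280) — see the module docstring; verbatim from the lens file. -/
@[simp] private theorem snoc2_zero (x : Fin 1 → ℝ) (t : ℝ) : (Fin.snoc x t : Fin 2 → ℝ) 0 = x 0 := rfl

/-- `snoc2_one`: auxiliary theorem of the lens-6 development «zeta2» (instances of 28994/4280) — see the module docstring; verbatim from the lens file. -/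
@[simp] private theorem snoc2_one (x : Fin 1 → ℝ) (t : ℝ) : (Fin.snoc x t : Fin 2 → ℝ) 1 = t := rfl

/-- `init2_zero`: auxiliary theorem of the lens-6 development «zeta2» (instances of 28994/4280) — see the module docstring; verbatim from the lens file. -/
@[simp] private theorem init2_zero (z : Fin 2 → ℝ) : Fin.init z 0 = z 0 := rfl

/-- `last_one_eq`: auxiliary theorem of the lens-6 development «zeta2» (instances of 28994/4280) — see the module docstring; verbatim from the lens file. -/
private theorem last_one_eq : (Fin.last 1 : Fin 2) = 1 := rfl

/-- **(unfold)** the fibrewise substitution `β(t) + a·t·x = β(t)(1 + tσ)`, i.e. `σ = a x/β(t)`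
(rule 2, `KZ.of_sub_of_mem_relations_of_fibreMap`): `[□², c·a/(β(t) + a t x)] ≡ SB(c; 0, a/β)` for
`β ∈ ℚ[t]` positive on `[0,1]` and a rational constant `a > 0` (base `t = z 0`, fibre `x = z 1`). -/
theorem sb_unfold (T : RFun 2) (c a : ℚ) (ha : 0 < a) (β : ℝ → ℝ) (pβ : MvPolynomial (Fin 2) ℚ)
    (hpβ : ∀ z : Fin 2 → ℝ, aeval z pβ = β (z 0)) (hβd : Differentiable ℝ β)
    (hβ : ∀ t ∈ Icc (0 : ℝ) 1, 0 < β t)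
    (hT : ∀ z ∈ cube 2, T.fn z = c * a / (β (z 0) + a * z 0 * z 1))
    (U : Edge) (hU : ∀ t ∈ Icc (0 : ℝ) 1, U.f t = a / β t) :
    KZ.of T.rep - KZ.of (SB c zeroE U) ∈ KZ.relations := by
  have hz0 : ∀ z ∈ cube 2, z 0 ∈ Icc (0 : ℝ) 1 := fun z hz => ⟨(hz 0).1, (hz 0).2⟩
  have ha' : (0 : ℝ) < a := by exact_mod_cast ha
  have hcube : cube 2 = KZlog.band (ivl 0 1) (fun _ => (0 : ℝ)) fun _ => 1 := by
    ext z
    rw [KZlog.mem_band, last_one_eq, mem_ivl, mem_cube, Fin.forall_fin_two]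
    simp only [init2_zero, Rat.cast_zero, Rat.cast_one]
  refine of_sub_of_mem_relations_of_fibreMap (G := ivl 0 1) (a := fun _ => (0 : ℝ)) (b := fun _ => 1)
    (a' := fun y => zeroE.f (y 0)) (b' := fun y => U.f (y 0))
    (fun z => a * z 1 / β (z 0)) (fun z => a / β (z 0))
    T.rep (SB c zeroE U) hcube rfl (fun _ _ => zero_le_one) ?_ ?_ ?_ ?_ ?_ ?_ ?_
  · refine (isSemialgebraicFunOn_aeval_div_aeval isSemialgebraic_cube (C a * X 1) pβ
      fun z hz => ?_).congr fun z _ => ?_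
    · rw [hpβ]; exact (hβ _ (hz0 z hz)).ne'
    · simp only [map_mul, aeval_C, aeval_X, eq_ratCast, hpβ]
  · intro z hz
    have hne := (hβ _ (hz0 z hz)).ne'
    fun_prop (disch := exact hne)
  · intro z hz
    show HasDerivAt (fun t => a * (Fin.snoc (Fin.init z) t : Fin 2 → ℝ) 1 /
      β ((Fin.snoc (Fin.init z) t : Fin 2 → ℝ) 0)) _ (z 1)
    simp only [snoc2_zero, snoc2_one, init2_zero]
    exact (((hasDerivAt_id' (z 1)).const_mul (a : ℝ)).div_const (β (z 0))).congr_deriv (by ring)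
  · intro z hz
    exact div_pos ha' (hβ _ (hz0 z hz))
  · intro y _
    show a * (Fin.snoc y (0 : ℝ) : Fin 2 → ℝ) 1 / β ((Fin.snoc y (0 : ℝ) : Fin 2 → ℝ) 0) = zeroE.f (y 0)
    simp only [snoc2_zero, snoc2_one, mul_zero, zero_div, zeroE_f]
  · intro y hy
    show a * (Fin.snoc y (1 : ℝ) : Fin 2 → ℝ) 1 / β ((Fin.snoc y (1 : ℝ) : Fin 2 → ℝ) 0) = U.f (y 0)
    simp only [snoc2_zero, snoc2_one, mul_one]
    exact (hU _ (I01 hy)).symm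
  · intro z hz
    have hzc : z ∈ cube 2 := hz
    have hβ' := hβ _ (hz0 z hzc)
    have hz0' : (0 : ℝ) ≤ z 0 := (hzc 0).1
    have hz1 : (0 : ℝ) ≤ z 1 := (hzc 1).1
    have hD : 0 < β (z 0) + a * z 0 * z 1 := by
      have := mul_nonneg (mul_nonneg ha'.le hz0') hz1
      linarith
    rw [RFun.rep_integrand, hT z hzc, SB_integrand]
    simp only [snoc2_zero, snoc2_one, init2_zero]
    field_simp
    try ring

/-- **(cube)** the square itself: `[□², c/(1+xy)] = SB(c; 0, 1)` (same domain, same integrand). -/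
theorem sb_cube (T : RFun 2) (c : ℚ) (hT : ∀ z ∈ cube 2, T.fn z = c / (1 + z 0 * z 1)) :
    KZ.of T.rep - KZ.of (SB c zeroE oneE) ∈ KZ.relations := by
  refine KZ.of_sub_of_mem_relations_of_eqOn ?_ fun z hz => ?_
  · show sbDom zeroE oneE = cube 2
    ext z
    rw [mem_sbDom, mem_cube, Fin.forall_fin_two]
    simp only [zeroE_f, oneE_f]
  · have hzc : z ∈ cube 2 := hz
    rw [RFun.rep_integrand, hT z hzc, SB_integrand]

/-! ## §3b Weight splitting (rule 1b) -/

/-- `SB(c₁ + c₂) ≡ SB(c₁) + SB(c₂)` (rule 1b, `KZ.integrandAddRel`). -/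
theorem sb_add' (c₁ c₂ c : ℚ) (h : c = c₁ + c₂) (L U : Edge) :
    KZ.of (SB c L U) - KZ.of (SB c₁ L U) - KZ.of (SB c₂ L U) ∈ KZ.relations := by
  refine KZ.integrandAddRel_subset_relations ⟨2, SB c L U, SB c₁ L U, SB c₂ L U, rfl, rfl,
    fun z _ => ?_, rfl⟩
  simp only [Pi.add_apply, SB_integrand, h, Rat.cast_add, add_div]

/-- `sb_half`: auxiliary theorem of the lens-6 development «zeta2» (instances of 28994/4280) — see the module docstring; verbatim from the lens file. -/
theorem sb_half (c : ℚ) (L U : Edge) :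
    KZ.of (SB c L U) - 2 • KZ.of (SB (c / 2) L U) ∈ KZ.relations := by
  have h := sb_add' (c / 2) (c / 2) c (by ring) L U
  convert h using 1
  abel

/-- `sb_third`: auxiliary theorem of the lens-6 development «zeta2» (instances of 28994/4280) — see the module docstring; verbatim from the lens file. -/
theorem sb_third (c : ℚ) (L U : Edge) :
    KZ.of (SB c L U) - 3 • KZ.of (SB (c / 3) L U) ∈ KZ.relations := by
  have h := add_mem (sb_add' (c / 3) (2 * c / 3) c (by ring) L U)
    (sb_add' (c / 3) (c / 3) (2 * c / 3) (by ring) L U)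
  convert h using 1
  abel

/-! ## §3c Open base: removing the null fibres over `t = 0, 1` (rule 1a) -/

/-- The open base interval `(0, 1) ⊆ ℝ¹`. -/
def oivl : Set (Fin 1 → ℝ) := {y | (0 : ℝ) < y 0 ∧ y 0 < 1}

/-- `isSemialgebraic_oivl`: auxiliary theorem of the lens-6 development «zeta2» (instances of 28994/4280) — see the module docstring; verbatim from the lens file. -/
theorem isSemialgebraic_oivl : IsSemialgebraic ℚ oivl := isSemialgebraic_unitInterval_fin_one

/-- `isOpen_oivl`: auxiliary theorem of the lens-6 development «zeta2» (instances of 28994/4280) — see the module docstring; verbatim from the lens file. -/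
theorem isOpen_oivl : IsOpen oivl := by
  have : oivl = (fun y : Fin 1 → ℝ => y 0) ⁻¹' Ioo 0 1 := by
    ext y; simp [oivl, mem_Ioo]
  rw [this]
  exact isOpen_Ioo.preimage (continuous_apply 0)

/-- `oivl_subset`: auxiliary theorem of the lens-6 development «zeta2» (instances of 28994/4280) — see the module docstring; verbatim from the lens file. -/
theorem oivl_subset : oivl ⊆ ivl 0 1 := fun y hy => by
  rw [mem_ivl]; push_cast; exact ⟨hy.1.le, hy.2.le⟩

/-- The sub-graph domain over the OPEN base. -/
def osbDom (L U : Edge) : Set (Fin 2 → ℝ) :=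
  KZlog.band oivl (fun y => L.f (y 0)) (fun y => U.f (y 0))

/-- `osbDom_subset`: auxiliary theorem of the lens-6 development «zeta2» (instances of 28994/4280) — see the module docstring; verbatim from the lens file. -/
theorem osbDom_subset (L U : Edge) : osbDom L U ⊆ sbDom L U := fun _ hz => ⟨oivl_subset hz.1, hz.2⟩

/-- `isSemialgebraic_osbDom`: auxiliary theorem of the lens-6 development «zeta2» (instances of 28994/4280) — see the module docstring; verbatim from the lens file. -/
theorem isSemialgebraic_osbDom (L U : Edge) : IsSemialgebraic ℚ (osbDom L U) :=
  KZlog.isSemialgebraic_band (L.sa.mono oivl_subset isSemialgebraic_oivl)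
    (U.sa.mono oivl_subset isSemialgebraic_oivl)

/-- Restriction of a representation on `sbDom L U` to the open base. -/
def opn (R : KZ.IntegralRep 2) (L U : Edge) (hR : R.domain = sbDom L U) : KZ.IntegralRep 2 :=
  R.restrict (osbDom L U) (isSemialgebraic_osbDom L U) (by rw [hR]; exact osbDom_subset L U)

/-- `volume_sbDom_diff_osbDom`: auxiliary theorem of the lens-6 development «zeta2» (instances of 28994/4280) — see the module docstring; verbatim from the lens file. -/
theorem volume_sbDom_diff_osbDom (L U : Edge) : volume (sbDom L U \ osbDom L U) = 0 := by
  refine measure_mono_null (fun z hz => ?_) (KZ.volume_setOf_init_mem_eq_zero (n := 1)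
    (measure_union_null (KZ.volume_setOf_last_eq_zero (n := 0) (0 : ℝ))
      (KZ.volume_setOf_last_eq_zero (n := 0) (1 : ℝ))))
  rcases hz with ⟨h1, h2⟩
  rcases mem_sbDom.1 h1 with ⟨⟨ha, hb⟩, -, -⟩
  have h2' : ¬ ((0 : ℝ) < z 0 ∧ z 0 < 1) := fun h => h2 ⟨h, h1.2⟩
  show Fin.init z (Fin.last 0) = 0 ∨ Fin.init z (Fin.last 0) = 1
  have : Fin.init z (Fin.last 0) = z 0 := rfl
  rw [this]
  by_contra hcon
  push Not at hcon
  exact h2' ⟨lt_of_le_of_ne ha (Ne.symm hcon.1), lt_of_le_of_ne hb hcon.2⟩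

/-- **(open)** `[sbDom, f] ≡ [osbDom, f]`: the fibres over `t = 0` and `t = 1` are null. -/
theorem rel_opn (R : KZ.IntegralRep 2) (L U : Edge) (hR : R.domain = sbDom L U) :
    KZ.of R - KZ.of (opn R L U hR) ∈ KZ.relations := by
  have hE : IsSemialgebraic ℚ (sbDom L U \ osbDom L U) := by
    exact (isSemialgebraic_sbDom L U).inter (isSemialgebraic_osbDom L U).compl
  have hnull := volume_sbDom_diff_osbDom L U
  let RE := R.restrict (sbDom L U \ osbDom L U) hE (by rw [hR]; exact fun z hz => hz.1)
  have h1 : KZ.of R - KZ.of (opn R L U hR) - KZ.of RE ∈ KZ.relations := by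
    refine KZ.domainAddRel_subset_relations ⟨2, R, opn R L U hR, RE, ?_, ?_, fun z _ => rfl,
      fun z _ => rfl, rfl⟩
    · show R.domain = osbDom L U ∪ (sbDom L U \ osbDom L U)
      rw [hR]; ext z
      constructor
      · intro hz
        by_cases h : z ∈ osbDom L U
        · exact Or.inl h
        · exact Or.inr ⟨hz, h⟩
      · rintro (h | h)
        · exact osbDom_subset L U h
        · exact h.1
    · show volume (osbDom L U ∩ (sbDom L U \ osbDom L U)) = 0
      exact measure_mono_null inter_subset_right hnull
  have h2 : KZ.of RE ∈ KZ.relations := KZ.of_mem_relations_of_volume_eq_zero RE hnull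
  have : KZ.of R - KZ.of (opn R L U hR) = (KZ.of R - KZ.of (opn R L U hR) - KZ.of RE) + KZ.of RE := by
    abel
  rw [this]
  exact add_mem h1 h2

/-! ## §3d The power maps `t ↦ tᵏ` (rule 2 twice: fibre scaling over the open base, then a base
substitution lifted to the band) -/

/-- `abs_div_le_of`: auxiliary theorem of the lens-6 development «zeta2» (instances of 28994/4280) — see the module docstring; verbatim from the lens file. -/
theorem abs_div_le_of {N D B : ℝ} (hN : |N| ≤ B) (hD : 1 ≤ D) : |N / D| ≤ B := by
  rw [abs_div, abs_of_pos (lt_of_lt_of_le one_pos hD)]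
  exact (div_le_self (abs_nonneg N) hD).trans hN

/-- A band representation on `sbDom L U` with a given bounded continuous semialgebraic integrand. -/
def BR (L U : Edge) (f : (Fin 2 → ℝ) → ℝ) (hf : IsSemialgebraicFunOn ℚ (sbDom L U) f)
    (hfc : ContinuousOn f (sbDom L U)) (B : ℝ) (hB : ∀ z ∈ sbDom L U, |f z| ≤ B) :
    KZ.IntegralRep 2 where
  domain := sbDom L U
  integrand := f
  isSemialgebraic_domain := isSemialgebraic_sbDom L U
  isSemialgebraicFunOn_integrand := hf
  integrableOn := by
    have hD := isSemialgebraic_sbDom L U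
    refine IntegrableOn.of_bound (volume_sbDom_lt_top L U)
      (hfc.aestronglyMeasurable (IsSemialgebraic.measurableSet_holds hD)) B ?_
    exact (ae_restrict_iff' (IsSemialgebraic.measurableSet_holds hD)).2 (ae_of_all _ fun z hz => by
      rw [Real.norm_eq_abs]; exact hB z hz)

/-- `BR_domain`: auxiliary theorem of the lens-6 development «zeta2» (instances of 28994/4280) — see the module docstring; verbatim from the lens file. -/
@[simp] theorem BR_domain (L U : Edge) (f hf hfc B hB) : (BR L U f hf hfc B hB).domain = sbDom L U := rfl
/-- `BR_integrand`: auxiliary theorem of the lens-6 development «zeta2» (instances of 28994/4280) — see the module docstring; verbatim from the lens file. -/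
@[simp] theorem BR_integrand (L U : Edge) (f hf hfc B hB) : (BR L U f hf hfc B hB).integrand = f := rfl

/-- The edge `1 + g`. -/
def Edge.onePlus (g : Edge) : Edge :=
  ⟨fun t => 1 + g.f t,
    (IsSemialgebraicFunOn.add_holds (isSemialgebraicFunOn_ratCast (isSemialgebraic_ivl 0 1) 1) g.sa).congr
      fun y _ => by simp,
    fun t ht => by linarith [g.nonneg t ht], continuousOn_const.add g.cont⟩

/-- `Edge.onePlus_f`: auxiliary theorem of the lens-6 development «zeta2» (instances of 28994/4280) — see the module docstring; verbatim from the lens file. -/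
@[simp] theorem Edge.onePlus_f (g : Edge) (t : ℝ) : g.onePlus.f t = 1 + g.f t := rfl

/-- `z0_mem`: auxiliary theorem of the lens-6 development «zeta2» (instances of 28994/4280) — see the module docstring; verbatim from the lens file. -/
theorem z0_mem {L U : Edge} {z : Fin 2 → ℝ} (hz : z ∈ sbDom L U) : z 0 ∈ Icc (0 : ℝ) 1 :=
  (mem_sbDom.1 hz).1

/-- `RA = [ {0 ≤ t ≤ 1, 0 ≤ τ ≤ gp(t)}, c·tʲ dτ dt/(1 + tʲ⁺¹ τ) ]` (after the fibre scaling). -/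
def RA (j : ℕ) (c : ℚ) (gp : Edge) : KZ.IntegralRep 2 :=
  BR zeroE gp (fun z => (c : ℝ) * z 0 ^ j / (1 + z 0 ^ (j + 1) * z 1))
    (by
      refine (isSemialgebraicFunOn_aeval_div_aeval (isSemialgebraic_sbDom zeroE gp) (C c * X 0 ^ j)
        (1 + X 0 ^ (j + 1) * X 1) fun z hz => ?_).congr fun z _ => ?_
      · have h0 := (z0_mem hz).1
        have h1 : 0 ≤ z 1 := by simpa using (mem_sbDom.1 hz).2.1
        simp only [map_add, map_one, map_mul, map_pow, aeval_X]
        nlinarith [mul_nonneg (pow_nonneg h0 (j + 1)) h1]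
      · simp only [map_add, map_one, map_mul, map_pow, aeval_X, aeval_C, eq_ratCast])
    (by
      refine ContinuousOn.div (by fun_prop) (by fun_prop) fun z hz => ?_
      have h0 := (z0_mem hz).1
      have h1 : 0 ≤ z 1 := by simpa using (mem_sbDom.1 hz).2.1
      nlinarith [mul_nonneg (pow_nonneg h0 (j + 1)) h1])
    |(c : ℝ)| (fun z hz => by
      have h0 := (z0_mem hz).1
      have h1 : 0 ≤ z 1 := by simpa using (mem_sbDom.1 hz).2.1
      refine abs_div_le_of ?_ (by nlinarith [mul_nonneg (pow_nonneg h0 (j + 1)) h1])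
      rw [abs_mul, abs_of_nonneg (pow_nonneg h0 j)]
      exact mul_le_of_le_one_right (abs_nonneg _) (pow_le_one₀ h0 (z0_mem hz).2))

/-- `RS = [ {0 ≤ t ≤ 1, 1 ≤ s ≤ 1 + gp(t)}, c·tʲ ds dt/(1 + tʲ⁺¹ (s − 1)) ]` (shifted fibre). -/
def RS (j : ℕ) (c : ℚ) (gp : Edge) : KZ.IntegralRep 2 :=
  BR oneE gp.onePlus (fun z => (c : ℝ) * z 0 ^ j / (1 + z 0 ^ (j + 1) * (z 1 - 1)))
    (by
      refine (isSemialgebraicFunOn_aeval_div_aeval (isSemialgebraic_sbDom oneE gp.onePlus)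
        (C c * X 0 ^ j) (1 + X 0 ^ (j + 1) * (X 1 - 1)) fun z hz => ?_).congr fun z _ => ?_
      · have h0 := (z0_mem hz).1
        have h1 : 0 ≤ z 1 - 1 := by have := (mem_sbDom.1 hz).2.1; simp at this; linarith
        simp only [map_add, map_sub, map_one, map_mul, map_pow, aeval_X]
        nlinarith [mul_nonneg (pow_nonneg h0 (j + 1)) h1]
      · simp only [map_add, map_sub, map_one, map_mul, map_pow, aeval_X, aeval_C, eq_ratCast])
    (by
      refine ContinuousOn.div (by fun_prop) (by fun_prop) fun z hz => ?_
      have h0 := (z0_mem hz).1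
      have h1 : 0 ≤ z 1 - 1 := by have := (mem_sbDom.1 hz).2.1; simp at this; linarith
      nlinarith [mul_nonneg (pow_nonneg h0 (j + 1)) h1])
    |(c : ℝ)| (fun z hz => by
      have h0 := (z0_mem hz).1
      have h1 : 0 ≤ z 1 - 1 := by have := (mem_sbDom.1 hz).2.1; simp at this; linarith
      refine abs_div_le_of ?_ (by nlinarith [mul_nonneg (pow_nonneg h0 (j + 1)) h1])
      rw [abs_mul, abs_of_nonneg (pow_nonneg h0 j)]
      exact mul_le_of_le_one_right (abs_nonneg _) (pow_le_one₀ h0 (z0_mem hz).2))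

/-- `RS' = [ {0 ≤ u ≤ 1, 1 ≤ s ≤ 1 + g(u)}, c' ds du/(1 + u (s − 1)) ]` (after the base map). -/
def RS' (c' : ℚ) (g : Edge) : KZ.IntegralRep 2 :=
  BR oneE g.onePlus (fun z => (c' : ℝ) / (1 + z 0 * (z 1 - 1)))
    (by
      refine (isSemialgebraicFunOn_aeval_div_aeval (isSemialgebraic_sbDom oneE g.onePlus)
        (C c') (1 + X 0 * (X 1 - 1)) fun z hz => ?_).congr fun z _ => ?_
      · have h0 := (z0_mem hz).1
        have h1 : 0 ≤ z 1 - 1 := by have := (mem_sbDom.1 hz).2.1; simp at this; linarith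
        simp only [map_add, map_sub, map_one, map_mul, aeval_X]
        nlinarith [mul_nonneg h0 h1]
      · simp only [map_add, map_sub, map_one, map_mul, aeval_X, aeval_C, eq_ratCast])
    (by
      refine ContinuousOn.div (by fun_prop) (by fun_prop) fun z hz => ?_
      have h0 := (z0_mem hz).1
      have h1 : 0 ≤ z 1 - 1 := by have := (mem_sbDom.1 hz).2.1; simp at this; linarith
      nlinarith [mul_nonneg h0 h1])
    |(c' : ℝ)| (fun z hz => by
      have h0 := (z0_mem hz).1
      have h1 : 0 ≤ z 1 - 1 := by have := (mem_sbDom.1 hz).2.1; simp at this; linarith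
      exact abs_div_le_of le_rfl (by nlinarith [mul_nonneg h0 h1]))

/-- `RA_integrand`: auxiliary theorem of the lens-6 development «zeta2» (instances of 28994/4280) — see the module docstring; verbatim from the lens file. -/
@[simp] theorem RA_integrand (j : ℕ) (c : ℚ) (gp : Edge) (z : Fin 2 → ℝ) :
    (RA j c gp).integrand z = (c : ℝ) * z 0 ^ j / (1 + z 0 ^ (j + 1) * z 1) := rfl
/-- `RS_integrand`: auxiliary theorem of the lens-6 development «zeta2» (instances of 28994/4280) — see the module docstring; verbatim from the lens file. -/
@[simp] theorem RS_integrand (j : ℕ) (c : ℚ) (gp : Edge) (z : Fin 2 → ℝ) :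
    (RS j c gp).integrand z = (c : ℝ) * z 0 ^ j / (1 + z 0 ^ (j + 1) * (z 1 - 1)) := rfl
/-- `RS'_integrand`: auxiliary theorem of the lens-6 development «zeta2» (instances of 28994/4280) — see the module docstring; verbatim from the lens file. -/
@[simp] theorem RS'_integrand (c' : ℚ) (g : Edge) (z : Fin 2 → ℝ) :
    (RS' c' g).integrand z = (c' : ℝ) / (1 + z 0 * (z 1 - 1)) := rfl

end Summit.KontsevichZagierPeriods.RootDecompQuadraticDescent.ZetaTwoPairs

end
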